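import Summits.CriticalPhenomena.PercolationContinuityZ3.Theorems.Transplant.SkelFrmFromBParamsKitS
import Summits.CriticalPhenomena.PercolationContinuityZ3.Theorems.Transplant.SkelFrmBParamsKitS
import Summits.CriticalPhenomena.PercolationContinuityZ3.Theorems.Transplant.SkelNegBParamsKitS
import Summits.CriticalPhenomena.PercolationContinuityZ3.Theorems.Transplant.SkelNegBChoiceAllS
import Summits.CriticalPhenomena.PercolationContinuityZ3.Theorems.Transplant.SkelPhiRunExitTable
import Summits.CriticalPhenomena.PercolationContinuityZ3.Theorems.Transplant.SkelFrmFrom1SlotTypes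
import Summits.CriticalPhenomena.PercolationContinuityZ3.Theorems.Transplant.SkelFrm1SlotTypes
import Summits.CriticalPhenomena.PercolationContinuityZ3.Theorems.Transplant.SkelFrmFrom1ParamsPO
import Summits.CriticalPhenomena.PercolationContinuityZ3.Theorems.Transplant.SkelFrm1ParamsPO
import Summits.CriticalPhenomena.PercolationContinuityZ3.Theorems.Transplant.SkelFrmFrom1ParamsLBL
import Summits.CriticalPhenomena.PercolationContinuityZ3.Theorems.Transplant.SkelFrm1ParamsLBL
import Summits.CriticalPhenomena.PercolationContinuityZ3.Theorems.Transplant.SkelFrmFromBParamsKitA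
import Summits.CriticalPhenomena.PercolationContinuityZ3.Theorems.Transplant.SkelFrmBParamsKitA
import Summits.CriticalPhenomena.PercolationContinuityZ3.Theorems.Transplant.SkelFrmFrom1ParamsLF
import Summits.CriticalPhenomena.PercolationContinuityZ3.Theorems.Transplant.SkelFrm1ParamsLF
import Summits.CriticalPhenomena.PercolationContinuityZ3.Theorems.Transplant.SkelFrmFrom1ParamsLO
import Summits.CriticalPhenomena.PercolationContinuityZ3.Theorems.Transplant.SkelFrm1ParamsLO
import Summits.CriticalPhenomena.PercolationContinuityZ3.Theorems.Transplant.SkelFrmFromBParamsLF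
import Summits.CriticalPhenomena.PercolationContinuityZ3.Theorems.Transplant.SkelFrmBParamsLF
import Summits.CriticalPhenomena.PercolationContinuityZ3.Theorems.Transplant.SkelFrmFromBParamsLO
import Summits.CriticalPhenomena.PercolationContinuityZ3.Theorems.Transplant.SkelFrmBParamsLO
import Summits.CriticalPhenomena.PercolationContinuityZ3.Theorems.Transplant.SkelFrmFromBParamsB
import Summits.CriticalPhenomena.PercolationContinuityZ3.Theorems.Transplant.SkelFrmBParamsB
import Summits.CriticalPhenomena.PercolationContinuityZ3.Theorems.Transplant.SkelFrmFromBParamsSlotsR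
import Summits.CriticalPhenomena.PercolationContinuityZ3.Theorems.Transplant.SkelFrmBParamsSlotsR
import Summits.CriticalPhenomena.PercolationContinuityZ3.Theorems.Transplant.SkelNegBParamsSlotsRS
import Summits.CriticalPhenomena.PercolationContinuityZ3.Theorems.Transplant.PlanarSkeletonFrmFromDefs
import Summits.CriticalPhenomena.PercolationContinuityZ3.Theorems.Transplant.PlanarSkeletonFrmDefs
import Summits.CriticalPhenomena.PercolationContinuityZ3.Theorems.Transplant.SkelPhiStepIDataNS
import HarnessLib
import Summits.CriticalPhenomena.PercolationContinuityZ3.Theorems.Transplant.SkelFrmBParamsSlotsRS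
/-!
# U-WAVE PORT (RULING D-U, lead g21 2026-08-26; WAVE-U-MANIFEST v3.1 row «SkelFrmBParamsSlotsRS» ↦ «SkelFrmFromBParamsSlotsRS») of the tree module
# `Transplant/SkelFrmBParamsSlotsRS` onto the carrier `PlanarSkeletonFrmFrom` (frames only, cylinders connected from width `ℓ₀` on)

ORIGINAL TITLE: N2 (frames-only node `SamePDropOfSkeletonFrmFrom₁`, OPEN) params column over `PlanarSkeletonFrm` — (ζ″) ledger, shape (B′) of record ((R-14)):

builds on p205010 (kernel theorem, internal audit signed; external expert review pending) — nothing in this file uses p205010; NOTHING is claimed about the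
OPEN node U `SamePDropOfSkeletonFrmFrom₁` (nor U_s / the end state).  Lane `prim-bschramm`, seat `prim-bschramm-stmt` gen 26 (port pen, RULING M-11 family P-stmt; tool = p3-g26's port_u.py of record, registry-driven inputs); helper file
(`--supports stmt-CriticalPhenomena-4575 --as helper`).  PORT RULES r1–r4 of RULING D-U: declaration order and proof texts are those of the original,
byte-identical except (i) the carrier token `PlanarSkeletonFrm ↦ PlanarSkeletonFrmFrom` (binders, `namespace`/`end` lines, qualified names of twinned
declarations), (ii) carrier-FREE declarations of the original (φ-level `Skelφ…` blocks and namespace-only arithmetic residents) are NOT re-declared —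
this file imports the original and `export`s the twin-free residents (POLICY T / treatment (m1)); residents whose statement mentions a twinned
constant are copied, (iii) every carrier-binding declaration keeps its explicit binder `(Φ : PlanarSkeletonFrmFrom G)` in its own signature (r2).  Docstrings and citations are the original's.
-/

noncomputable section

open scoped Classical

namespace Summit.CriticalPhenomena.PercolationContinuityZ3.Theorems.Transplant

namespace PlanarSkeletonFrmFrom

namespace NegB

namespace KS

open MeasureTheory Literature.Probability.Percolation Literature.Probability.LatticeModels SimpleGraph
open SkelConc (Consts)
open Skelφ (oriφ trφ)
open Skelφ.StepI (DataN OutO)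
open Neg

/-! ## §1 The bridge slot values at `R′ := KS.RA'` -/

section BridgeR

/-- **THE BRIDGE CLEARANCE OF RECORD** `b := Δ₀ := D.k + 2·R′ + 1` at `R′ := KS.RA'`. [this work] -/
def bR (κ : Consts) {V : Type} [Countable V] {G : SimpleGraph V} [G.LocallyFinite] (Φ : PlanarSkeletonFrmFrom G) (t : V) (p : unitInterval) (D : Skelφ.StepI.DataNS V) (mk : ℕ) : ℕ := D.k + 2 * RA' κ Φ t p D mk + 1

/-- **THE BRIDGE ZONE-INDEX FLOOR OF RECORD** `mb := max (2Δ₀ + 26) (24·M_u + 63)`. [this work] -/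
def mbR (κ : Consts) {V : Type} [Countable V] {G : SimpleGraph V} [G.LocallyFinite] (Φ : PlanarSkeletonFrmFrom G) (t : V) (p : unitInterval) (D : Skelφ.StepI.DataNS V) (mk : ℕ) : ℕ := max (2 * bR κ Φ t p D mk + 26) (24 * Mu D + 63)

/-- `bR = D.k + 2·RA' + 1`, `D.k ≤ bR`, `2·RA' + 1 ≤ bR`. [folklore] -/
theorem bR_eq (κ : Consts) {V : Type} [Countable V] {G : SimpleGraph V} [G.LocallyFinite] (Φ : PlanarSkeletonFrmFrom G) (t : V) (p : unitInterval) (D : Skelφ.StepI.DataNS V) (mk : ℕ) : bR κ Φ t p D mk = D.k + 2 * RA' κ Φ t p D mk + 1 ∧ D.k ≤ bR κ Φ t p D mk ∧ 2 * RA' κ Φ t p D mk + 1 ≤ bR κ Φ t p D mk :=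
  ⟨rfl, by unfold bR; omega, by unfold bR; omega⟩

/-- `2·bR + 26 ≤ mbR` and `24·M_u + 63 ≤ mbR`. [folklore] -/
theorem mbR_floors (κ : Consts) {V : Type} [Countable V] {G : SimpleGraph V} [G.LocallyFinite] (Φ : PlanarSkeletonFrmFrom G) (t : V) (p : unitInterval) (D : Skelφ.StepI.DataNS V) (mk : ℕ) : 2 * bR κ Φ t p D mk + 26 ≤ mbR κ Φ t p D mk ∧ 24 * Mu D + 63 ≤ mbR κ Φ t p D mk := ⟨le_max_left _ _, le_max_right _ _⟩

/-- The bridge zone index at the slot values. [this work] -/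
abbrev MBR (κ : Consts) {V : Type} [Countable V] {G : SimpleGraph V} [G.LocallyFinite] (Φ : PlanarSkeletonFrmFrom G) (t : V) (p : unitInterval) (D : Skelφ.StepI.DataNS V) (mk : ℕ) : ℕ := MB D (mbR κ Φ t p D mk)

/-- The bridge width at the slot values. [this work] -/
abbrev nBR (κ : Consts) {V : Type} [Countable V] {G : SimpleGraph V} [G.LocallyFinite] (Φ : PlanarSkeletonFrmFrom G) (t : V) (p : unitInterval) (D : Skelφ.StepI.DataNS V) (mk : ℕ) : ℕ := nB D (mbR κ Φ t p D mk) (bR κ Φ t p D mk)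

/-- The bridge shear at the slot values. [this work] -/
abbrev hBR (κ : Consts) {V : Type} [Countable V] {G : SimpleGraph V} [G.LocallyFinite] (Φ : PlanarSkeletonFrmFrom G) (t : V) (p : unitInterval) (D : Skelφ.StepI.DataNS V) (mk : ℕ) : ℤ := hB t D (mbR κ Φ t p D mk) (bR κ Φ t p D mk)

/-- The bridge half-length at the slot values. [this work] -/
abbrev ℓBR (κ : Consts) {V : Type} [Countable V] {G : SimpleGraph V} [G.LocallyFinite] (Φ : PlanarSkeletonFrmFrom G) (t : V) (p : unitInterval) (D : Skelφ.StepI.DataNS V) (mk : ℕ) : ℕ := ℓB t D (mbR κ Φ t p D mk) (bR κ Φ t p D mk)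

/-- The bridge split point at the slot values. [this work] -/
abbrev vBR (κ : Consts) {V : Type} [Countable V] {G : SimpleGraph V} [G.LocallyFinite] (Φ : PlanarSkeletonFrmFrom G) (t : V) (p : unitInterval) (D : Skelφ.StepI.DataNS V) (mk : ℕ) : ℤ := vB t D (mbR κ Φ t p D mk) (bR κ Φ t p D mk)

/-- **The bridge pair at the slot values is admissible.** [folklore] -/
theorem bridgeR_adm (κ : Consts) {V : Type} [Countable V] {G : SimpleGraph V} [G.LocallyFinite] (Φ : PlanarSkeletonFrmFrom G) (t : V) (p : unitInterval) (D : Skelφ.StepI.DataNS V) (mk : ℕ) : D.M₀ ≤ (MBR κ Φ t p D mk, nBR κ Φ t p D mk).1 ∧ D.n₁ (MBR κ Φ t p D mk, nBR κ Φ t p D mk).1 ≤ (MBR κ Φ t p D mk, nBR κ Φ t p D mk).2 :=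
  bridge_adm D _ _

/-- **(R-F2) at the values**: `bR ≤ n_b`, `M_b < n_b`, `M_b + bR + 2 + ρz ≤ n_b`. [folklore] -/
theorem RF2_R (κ : Consts) {V : Type} [Countable V] {G : SimpleGraph V} [G.LocallyFinite] (Φ : PlanarSkeletonFrmFrom G) (t : V) (p : unitInterval) (D : Skelφ.StepI.DataNS V) (mk : ℕ) : bR κ Φ t p D mk ≤ nBR κ Φ t p D mk ∧ MBR κ Φ t p D mk < nBR κ Φ t p D mk ∧ MBR κ Φ t p D mk + bR κ Φ t p D mk + 2 + ρz D ≤ nBR κ Φ t p D mk :=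
  ⟨(nB_facts D _ _).2.2.1, (nB_facts D _ _).2.1, (nB_facts D _ _).2.2.2⟩

/-- **The zone-index floors at the values**: `2·bR + 26 ≤ M_b`, `24·M_u + 63 ≤ M_b`, `M_u ≤ M_b`. [folklore] -/
theorem MB_floorsR (κ : Consts) {V : Type} [Countable V] {G : SimpleGraph V} [G.LocallyFinite] (Φ : PlanarSkeletonFrmFrom G) (t : V) (p : unitInterval) (D : Skelφ.StepI.DataNS V) (mk : ℕ) : 2 * bR κ Φ t p D mk + 26 ≤ MBR κ Φ t p D mk ∧ 24 * Mu D + 63 ≤ MBR κ Φ t p D mk ∧ Mu D ≤ MBR κ Φ t p D mk := by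
  have h1 := (MB_facts D (mbR κ Φ t p D mk)).2.1
  have h2 := mbR_floors κ Φ t p D mk
  exact ⟨h2.1.trans h1, h2.2.trans h1, (MB_facts D _).1⟩

/-- **The one-stride room at the values**: `2·bR + 27 ≤ ℓ_b` (from `EqGeom` at the bridge pair, any map). [folklore] -/
theorem ℓBR_ge (κ : Consts) {V : Type} [Countable V] {G : SimpleGraph V} [G.LocallyFinite] (Φ : PlanarSkeletonFrmFrom G) (t : V) (p : unitInterval) (D : Skelφ.StepI.DataNS V) (mk : ℕ) (ψ : V → Site 2) (hE : D.EqGeom G ψ t (MBR κ Φ t p D mk) (nBR κ Φ t p D mk)) : 2 * bR κ Φ t p D mk + 27 ≤ ℓBR κ Φ t p D mk := by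
  have h1 := ℓB_ge t D (mbR κ Φ t p D mk) (bR κ Φ t p D mk) ψ hE
  have h2 := (mbR_floors κ Φ t p D mk).1
  show _ ≤ ℓB t D (mbR κ Φ t p D mk) (bR κ Φ t p D mk)
  omega

end BridgeR

/-! ## §1b The first kit level against the apron's clamp -/

section Levels

/-- **`tanOff apron.ℓs apron.M ≤ j₀`** (p1-g11 2026-08-21T17:00:06Z). [folklore] -/
theorem j₀A_ge {V : Type} {G : SimpleGraph V} [G.LocallyFinite] (Φ : PlanarSkeletonFrmFrom G) (t : V) (D : Skelφ.StepI.DataNS V) (mk : ℕ) (A : ℤ) (r₀ : ℕ) : SkelI.tanOff (apron Φ t D mk A r₀).ℓs (apron Φ t D mk A r₀).M ≤ j₀A t D mk := by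
  rw [tanOff_apron]; rfl

/-- `j₀ ≤ j → tanOff ℓs M ≤ j`. [folklore] -/
theorem le_of_j₀A_le {V : Type} {G : SimpleGraph V} [G.LocallyFinite] (Φ : PlanarSkeletonFrmFrom G) (t : V) (D : Skelφ.StepI.DataNS V) (mk : ℕ) (A : ℤ) (r₀ : ℕ) {j : ℕ} (hj : j₀A t D mk ≤ j) : SkelI.tanOff (apron Φ t D mk A r₀).ℓs (apron Φ t D mk A r₀).M ≤ j :=
  (j₀A_ge Φ t D mk A r₀).trans hj

end Levels

/-! ## §2 The kit pair, oriented; the relative orientation `oS` -/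

section KitO

/-- **The kit pair's orientation bit** `o_kit := ori t M_kit n_kit` (values at the merged record). [this work] -/
def oK {V : Type} (t : V) (D : Skelφ.StepI.DataNS V) (DT : DataN V) (ori : V → ℕ → ℕ → Bool) (mk : ℕ) : Bool := ori t (MK (D.orient DT ori) mk) (nKit (D.orient DT ori) mk)

/-- **The planar map the KIT PIECES live in**: `Φ.φ` or its transpose. [this work] -/
def φK {V : Type} {G : SimpleGraph V} [G.LocallyFinite] (Φ : PlanarSkeletonFrmFrom G) (t : V) (D : Skelφ.StepI.DataNS V) (DT : DataN V) (ori : V → ℕ → ℕ → Bool) (mk : ℕ) : V → Site 2 := oriφ Φ.φ (oK t D DT ori mk)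

/-- `φK` is 1-Lipschitz. [folklore] -/
theorem lip_φK {V : Type} {G : SimpleGraph V} [G.LocallyFinite] (Φ : PlanarSkeletonFrmFrom G) (t : V) (D : Skelφ.StepI.DataNS V) (DT : DataN V) (ori : V → ℕ → ℕ → Bool) (mk : ℕ) : Skelφ.Lip G (φK Φ t D DT ori mk) := Skelφ.lip_oriφ Φ.lip _

/-- `φK` has unit steps. [folklore] -/
theorem steps_φK {V : Type} {G : SimpleGraph V} [G.LocallyFinite] (Φ : PlanarSkeletonFrmFrom G) (t : V) (D : Skelφ.StepI.DataNS V) (DT : DataN V) (ori : V → ℕ → ℕ → Bool) (mk : ℕ) : Skelφ.Steps G (φK Φ t D DT ori mk) := Skelφ.steps_oriφ Φ.step _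

export PlanarSkeletonNeg.NegB.KS (trφ_trφ)

/-- **The RELATIVE orientation of the kit pair in the long run's frame** (p1's `ShortPcO.oS`: `true` = the run's map `φL`, `false` = `trφ φL`): `oS := (oK == oL)`. [this work] -/
def oS (κ : Consts) {V : Type} [DecidableEq V] [Countable V] {G : SimpleGraph V} [G.LocallyFinite] (Φ : PlanarSkeletonFrmFrom G) (t : V) (p : unitInterval) (D : Skelφ.StepI.DataNS V) (DT : DataN V) (ori : V → ℕ → ℕ → Bool) (g : ℕ) (f : ℕ) (mk : ℕ) : Bool := (oK t D DT ori mk == oL κ Φ t p D DT ori g f)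

/-- **`oriφ φL oS = φK`**: the kit pieces, read in the run's chart with the flag `oS`, are the served ones. [folklore] -/
theorem oriφ_φL_oS (κ : Consts) {V : Type} [DecidableEq V] [Countable V] {G : SimpleGraph V} [G.LocallyFinite] (Φ : PlanarSkeletonFrmFrom G) (t : V) (p : unitInterval) (D : Skelφ.StepI.DataNS V) (DT : DataN V) (ori : V → ℕ → ℕ → Bool) (g : ℕ) (f : ℕ) (mk : ℕ) : oriφ (φL κ Φ t p D DT ori g f) (oS κ Φ t p D DT ori g f mk) = φK Φ t D DT ori mk := by
  unfold oS φK φL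
  cases oK t D DT ori mk <;> cases oL κ Φ t p D DT ori g f <;> simp [Skelφ.oriφ_true, Skelφ.oriφ_false, trφ_trφ]

/-- **THE KIT PAIR's CLAUSE FROM `FactsO`** (map `φK`, `|h_kit| ≤ 10·n_kit`). [this work] -/
theorem clauseK_of_factsO {V : Type} {G : SimpleGraph V} [G.LocallyFinite] (Φ : PlanarSkeletonFrmFrom G) (t : V) (D : Skelφ.StepI.DataNS V) (DT : DataN V) (ori : V → ℕ → ℕ → Bool) (mk : ℕ) (hR : DT.R = D.R)
    (hfacts : ∀ M, D.M₀ ≤ M → ∀ n, D.n₁ M ≤ n →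
      (ori t M n = true → D.EqGeom G Φ.φ t M n ∧ (D.hgt t M n).natAbs ≤ 10 * n) ∧
      (ori t M n = false → DT.EqGeom G (trφ Φ.φ) t M n ∧ (DT.hgt t M n).natAbs ≤ 10 * n)) :
    (D.orient DT ori).EqGeom G (φK Φ t D DT ori mk) t (MK (D.orient DT ori) mk) (nKit (D.orient DT ori) mk) ∧
      (hKit t (D.orient DT ori) mk).natAbs ≤ 10 * nKit (D.orient DT ori) mk :=
  Skelφ.StepI.orient_clause_all hR hfacts _ (MK_facts _ mk).2.2.1 _ (nKit_facts _ mk).1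

/-- The kit pair's geometric facts unpacked (ℤ shapes), any map. [folklore] -/
theorem eqNumK_of_eqGeom {V : Type} {G : SimpleGraph V} [G.LocallyFinite] (t : V) (D : Skelφ.StepI.DataNS V) (mk : ℕ) (ψ : V → Site 2) (hE : D.EqGeom G ψ t (PlanarSkeletonFrmFrom.NegB.KS.MK D mk) (nKit D mk)) :
    MK D mk < nKit D mk ∧ MK D mk < ℓKit t D mk ∧ |vKit t D mk| ≤ (nKit D mk : ℤ) ∧
      ((MK D mk : ℤ) + 1) * ((nKit D mk : ℤ) + |hKit t D mk|) ≤ (nKit D mk : ℤ) * ((ℓKit t D mk : ℤ) + 1) :=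
  eqGeom_num_of t D ψ hE

/-- **p1's exit-table floor at the kit pair**: `24·M_u + 64 ≤ ℓ_kit` (from `M_kit < ℓ_kit`). [folklore] -/
theorem ℓKit_ge {V : Type} {G : SimpleGraph V} [G.LocallyFinite] (t : V) (D : Skelφ.StepI.DataNS V) (mk : ℕ) (ψ : V → Site 2) (hE : D.EqGeom G ψ t (MK D mk) (nKit D mk)) : 24 * Mu D + 64 ≤ ℓKit t D mk := by
  have h := (eqNumK_of_eqGeom t D mk ψ hE).2.1
  have h2 := (MK_facts D mk).2.1
  omega

/-- **THE ORIENTED SHORT-PIECE RECORD OF THE KIT PAIR** (p1's `ShortPcO`): `QK` + `oS`. [this work] -/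
def QKO (κ : Consts) {V : Type} [DecidableEq V] [Countable V] {G : SimpleGraph V} [G.LocallyFinite] (Φ : PlanarSkeletonFrmFrom G) (t : V) (p : unitInterval) (D : Skelφ.StepI.DataNS V) (DT : DataN V) (ori : V → ℕ → ℕ → Bool) (g : ℕ) (f : ℕ) (mk : ℕ) : Skelφ.ShortPcO V := { QK t (D.orient DT ori) mk with oS := fun _ => oS κ Φ t p D DT ori g f mk }

/-- The fields of `QKO` (all `rfl`). [folklore] -/
theorem QKO_facts (κ : Consts) {V : Type} [DecidableEq V] [Countable V] {G : SimpleGraph V} [G.LocallyFinite] (Φ : PlanarSkeletonFrmFrom G) (t : V) (p : unitInterval) (D : Skelφ.StepI.DataNS V) (DT : DataN V) (ori : V → ℕ → ℕ → Bool) (g : ℕ) (f : ℕ) (mk : ℕ) (c : V) : (QKO κ Φ t p D DT ori g f mk).nS c = nKit (D.orient DT ori) mk ∧ (QKO κ Φ t p D DT ori g f mk).hS c = hKit t (D.orient DT ori) mk ∧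
    (QKO κ Φ t p D DT ori g f mk).ℓS c = ℓKit t (D.orient DT ori) mk ∧ (QKO κ Φ t p D DT ori g f mk).RS c = RK t (D.orient DT ori) mk ∧
    (QKO κ Φ t p D DT ori g f mk).vS c = vKit t (D.orient DT ori) mk ∧ (QKO κ Φ t p D DT ori g f mk).oS c = oS κ Φ t p D DT ori g f mk :=
  ⟨rfl, rfl, rfl, rfl, rfl, rfl⟩

/-- **`RgO φL QKO c = RgK φK c`**: p1's oriented short region in the run's chart is the kit block's region over `φK`. [folklore] -/
theorem RgO_QKO (κ : Consts) {V : Type} [DecidableEq V] [Countable V] {G : SimpleGraph V} [G.LocallyFinite] (Φ : PlanarSkeletonFrmFrom G) (t : V) (p : unitInterval) (D : Skelφ.StepI.DataNS V) (DT : DataN V) (ori : V → ℕ → ℕ → Bool) (g : ℕ) (f : ℕ) (mk : ℕ) (c : V) :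
    Skelφ.RgO G (φL κ Φ t p D DT ori g f) (QKO κ Φ t p D DT ori g f mk) c = RgK G t (D.orient DT ori) mk (φK Φ t D DT ori mk) c := by
  unfold Skelφ.RgO RgK
  rw [show (QKO κ Φ t p D DT ori g f mk).oS c = oS κ Φ t p D DT ori g f mk from rfl, oriφ_φL_oS]
  rfl

end KitO

end KS
end NegB
end PlanarSkeletonFrmFrom
end Summit.CriticalPhenomena.PercolationContinuityZ3.Theorems.Transplant
end
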